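import Summits.CriticalPhenomena.SAWScalingLimit.Theorems.SAWDevelopingMapHexConjectureKPDefs
import HarnessLib

/-!
# Crux `HexConjecture` (stmt-CriticalPhenomena-0808), line `root-locality-replaces-loewner`:
Krachun–Panagiotis construction (b) (registered stub `stub_kp_glueB`)

Landing target:
`Summits/CriticalPhenomena/SAWScalingLimit/Theorems/SAWDevelopingMapHexConjectureKPGlueB.lean`
(`--supports stmt-CriticalPhenomena-0808`).

Construction (b) of [KP, §3.2, Fig. 5]: glue `γ₁ ∈ D(Tria_{2k+1})` ending at the right-side mid-edge
`x`, a walk `γ₂` of the trapezoid `Trap_{2i+1,x}` from `x` to its right side ending at `y`, and a walk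
`γ₃` of the triangle `y + e^{4πi/3} Tria_{2r}` from `y` to its side on the real axis: "By concatenating
`γ₁`, `γ₂` and `γ₃`, we obtain a self-avoiding walk" of the upper half-plane from `a` to the real axis.
In the coordinate model (`HV.IsMidWalk`, lists `w :: (l ++ [u])`): `P₁ ∈ rightWalks k` with final
dart `((x₀,x₁,false), (x₀,x₁,true))` (`x₀ + x₁ = k`, `0 ≤ x₁ ≤ 2k`); `P₂` a mid-edge walk of the
clipped triangle `clipV i x₁` (the trapezoid in the frame of the attached triangle) with final dart
the right dart `((p₀,p₁,false), (p₀,p₁,true))` (`p₀ + p₁ = i`, `p₀ ≤ x₁`), placed by the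
automorphism `φ = attach x₀ x₁` sending the root dart `(w, O)` onto the final dart of `P₁`;
`P₃ ∈ rightWalks r`, `r = x₁ - p₀`, placed by `φ ∘ ψ`, `ψ = attach p₀ p₁`.

* ABSTRACT GLUING (any automorphisms `φ ψ`, any domains; imitating `HV.GlueData`, Glazman–Manolescu's
  gluing): `kpGlueB_eq` — the glued list `P₁ ++ (P₂.map φ).drop 2 ++ ((P₃.map ψ).map φ).drop 2` is
  `w :: (l₁ ++ (l₂.map φ ++ (l₃.map ψ).map φ) ++ [φ (ψ u₃)])` (the two junction darts are shared);
  `kpGlueB_isMidWalk` — it is a self-avoiding mid-edge walk of `W` as soon as the three placed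
  domains lie in `W` and are pairwise disjoint and the placed exit vertex is outside `W` and is not
  `w`; `kpGlueB_finalDart`, `kpGlueB_mwLen` — its final dart is the placed final dart of the third
  piece and the lengths add.
* COORDINATES (all by `attach_apply` and linear arithmetic): `φ` maps a cell `Y` of the second frame
  to slanted level `k + 1 + Y₁ ≥ k + 1` and height `x₁ - Y₀ ≥ 0` (`kpGlueB_region₂`); `ψ` maps a cell
  `z ∈ T_r` to slanted level `i + 1 + z₁ ≥ i + 1` of the second frame (beyond the second piece,
  `slev ≤ i`) with `Y₀ ≤ x₁` and `Y₁ = p₁ - z₀ ≥ i - x₁ ≥ 0` (hypothesis `2k ≤ i`), so `φ ψ z` has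
  slanted level `≥ k + 1` (beyond the first piece, `slev ≤ k`) — `kpGlueB_region₃`; all placed cells
  lie in `S_{N+1,N+1}` once `6k + 4i + 4 ≤ N + 1`; the final dart `((z₀,z₁,false), (z₀,z₁,true))` of
  `P₃` goes to the floor dart `((d,0,false), (d,-1,true))`, `d = k + 1 + p₁ - z₀ ∈ [i+1-k, 3k+3i+1]`
  (`kpGlueB_exit`).
* `stub_kp_glueB` (registered) assembles these.
-/

noncomputable section

open Finset
open Literature.Probability.RandomPlanarGeometry.SAW Literature.Probability.RandomPlanarGeometry.SAW.HV

namespace Summit.CriticalPhenomena.SAWScalingLimit.Theorems.HexConjecture.RootLocality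

/-! ### Anatomy of the pieces -/

/-- **Anatomy of a piece ending with an "up" dart** `((a,b,false), (a,b,true))` (a right dart of a
triangle): the walk is `w :: (l ++ [(a,b,true)])` with `l ≠ []`, `l` ends at the cell `(a,b,false)`,
which lies in the domain. [cite: KrachunPanagiotis2026, §3.2] -/
theorem kpGlueB_anatomy {V : Finset HV} {P : List HV} (hP : IsMidWalk V P) {a b : ℤ}
    (hfd : finalDart P = ((a, b, false), (a, b, true))) :
    ∃ (l : List HV) (hl : l ≠ []), P = wOut :: (l ++ [(a, b, true)]) ∧
      l.getLast hl = (a, b, false) ∧ l.head? = some hvOrigin ∧ (a, b, false) ∈ V := by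
  rcases hP.trivial_or_exists with rfl | ⟨l, u, hl, rfl⟩
  · rw [finalDart_trivial] at hfd
    simp [wOut] at hfd
  rw [finalDart_cons_append hl] at hfd
  obtain ⟨h1, h2⟩ := Prod.mk.inj hfd
  subst h2
  obtain ⟨-, hh, -, hV, -, -⟩ := (isMidWalk_cons_append_iff V hl _).1 hP
  refine ⟨l, hl, rfl, h1, hh, ?_⟩
  rw [← h1]
  exact hV _ (List.getLast_mem hl)

/-- The entries of `(P.map f).drop 2` for a piece `P = w :: (l ++ [u])` (so `P = w, O, …`): images of
entries of `l` or of the exit vertex `u`. [folklore] -/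
theorem kpGlueB_mem_drop_two {l : List HV} (hd : l.head? = some hvOrigin) {u v : HV} {f : HV → HV}
    (hv : v ∈ ((wOut :: (l ++ [u])).map f).drop 2) : ∃ y, (y ∈ l ∨ y = u) ∧ f y = v := by
  obtain ⟨t, rfl⟩ : ∃ t, l = hvOrigin :: t := ⟨l.tail, GlueData.eq_cons_of_head hd⟩
  simp only [List.cons_append, List.map_cons, List.map_append, List.map_nil, List.drop_succ_cons,
    List.drop_zero, List.mem_append, List.mem_map, List.mem_cons, List.not_mem_nil, or_false] at hv
  rcases hv with ⟨y, hy, rfl⟩ | rfl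
  · exact ⟨y, Or.inl (List.mem_cons_of_mem _ hy), rfl⟩
  · exact ⟨u, Or.inr rfl, rfl⟩

/-! ### The glued list -/

section Glue

variable {V₁ V₂ V₃ W : Finset HV} {l₁ l₂ l₃ : List HV} {u₃ : HV} (φ ψ : hvGraph ≃g hvGraph)

/-- **The glued list, unfolded**: with `P₁ = w :: (l₁ ++ [φ O])`, `P₂ = w :: (l₂ ++ [ψ O])`,
`P₃ = w :: (l₃ ++ [u₃])` (`l₂`, `l₃` starting at `O`), the concatenation
`P₁ ++ (P₂.map φ).drop 2 ++ ((P₃.map ψ).map φ).drop 2` is the mid-edge walk list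
`w :: (l₁ ++ (l₂.map φ ++ (l₃.map ψ).map φ) ++ [φ (ψ u₃)])`. [cite: KrachunPanagiotis2026, §3.2 (construction (b))] -/
theorem kpGlueB_eq (hd₂ : l₂.head? = some hvOrigin) (hd₃ : l₃.head? = some hvOrigin) (l₁ : List HV)
    (u₃ : HV) :
    wOut :: (l₁ ++ [φ hvOrigin]) ++ ((wOut :: (l₂ ++ [ψ hvOrigin])).map φ).drop 2 ++
        (((wOut :: (l₃ ++ [u₃])).map ψ).map φ).drop 2 =
      wOut :: (l₁ ++ (l₂.map φ ++ (l₃.map ψ).map φ) ++ [φ (ψ u₃)]) := by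
  obtain ⟨t₂, rfl⟩ : ∃ t, l₂ = hvOrigin :: t := ⟨l₂.tail, GlueData.eq_cons_of_head hd₂⟩
  obtain ⟨t₃, rfl⟩ : ∃ t, l₃ = hvOrigin :: t := ⟨l₃.tail, GlueData.eq_cons_of_head hd₃⟩
  simp only [List.cons_append, List.map_cons, List.map_append, List.map_nil, List.drop_succ_cons,
    List.drop_zero, List.append_assoc, List.nil_append]

/-- The glued inner list is nonempty. [folklore] -/
theorem kpGlueB_ne_nil (h₁ : l₁ ≠ []) (l₂ l₃ : List HV) :
    l₁ ++ (l₂.map φ ++ (l₃.map ψ).map φ) ≠ [] :=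
  List.append_ne_nil_of_left_ne_nil h₁ _

/-- **The abstract three-piece gluing** of Krachun–Panagiotis's construction (b).  If
`w :: (l₁ ++ [φ O])`, `w :: (l₂ ++ [ψ O])`, `w :: (l₃ ++ [u₃])` are mid-edge walks of `V₁`, `V₂`, `V₃`,
the sets `V₁`, `φ V₂`, `φ ψ V₃` lie in `W` and are pairwise disjoint, and the placed exit vertex
`φ (ψ u₃)` is outside `W` and is not `w`, then the glued list is a mid-edge walk of `W` (chain through
the two shared junction darts, self-avoiding by disjointness, non-retracing at the end).
[cite: KrachunPanagiotis2026, §3.2 (construction (b), "By concatenating γ₁, γ₂ and γ₃, we obtain a self-avoiding walk")] -/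
theorem kpGlueB_isMidWalk (h₁ : l₁ ≠ []) (h₂ : l₂ ≠ []) (h₃ : l₃ ≠ [])
    (w₁ : IsMidWalk V₁ (wOut :: (l₁ ++ [φ hvOrigin])))
    (w₂ : IsMidWalk V₂ (wOut :: (l₂ ++ [ψ hvOrigin]))) (w₃ : IsMidWalk V₃ (wOut :: (l₃ ++ [u₃])))
    (s₁ : ∀ x ∈ V₁, x ∈ W) (s₂ : ∀ y ∈ V₂, φ y ∈ W) (s₃ : ∀ z ∈ V₃, φ (ψ z) ∈ W)
    (d₁₂ : ∀ x ∈ V₁, ∀ y ∈ V₂, x ≠ φ y) (d₁₃ : ∀ x ∈ V₁, ∀ z ∈ V₃, x ≠ φ (ψ z))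
    (d₂₃ : ∀ y ∈ V₂, ∀ z ∈ V₃, y ≠ ψ z) (hu : φ (ψ u₃) ∉ W) (huw : φ (ψ u₃) ≠ wOut) :
    IsMidWalk W (wOut :: (l₁ ++ (l₂.map φ ++ (l₃.map ψ).map φ) ++ [φ (ψ u₃)])) := by
  obtain ⟨c₁, hd₁, a₁, m₁, n₁, -⟩ := (isMidWalk_cons_append_iff V₁ h₁ _).1 w₁
  obtain ⟨c₂, hd₂, a₂, m₂, n₂, -⟩ := (isMidWalk_cons_append_iff V₂ h₂ _).1 w₂
  obtain ⟨c₃, hd₃, a₃, m₃, n₃, -⟩ := (isMidWalk_cons_append_iff V₃ h₃ _).1 w₃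
  have h3 : (l₃.map ψ).map φ ≠ [] := by simp [h₃]
  -- every glued vertex lies in `W`
  have hMW : ∀ x ∈ l₁ ++ (l₂.map φ ++ (l₃.map ψ).map φ), x ∈ W := by
    intro x hx
    rw [List.mem_append, List.mem_append] at hx
    rcases hx with hx | hx | hx
    · exact s₁ x (m₁ x hx)
    · obtain ⟨y, hy, rfl⟩ := List.mem_map.1 hx
      exact s₂ y (m₂ y hy)
    · obtain ⟨y, hy, rfl⟩ := List.mem_map.1 hx
      obtain ⟨z, hz, rfl⟩ := List.mem_map.1 hy
      exact s₃ z (m₃ z hz)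
  rw [isMidWalk_cons_append_iff W (kpGlueB_ne_nil φ ψ h₁ l₂ l₃)]
  refine ⟨?_, ?_, ?_, hMW, ?_, ?_⟩
  · -- a lattice path: three chains, adjacent across the two junctions
    have c₂' : (l₂.map φ).IsChain hvGraph.Adj := by
      rw [List.isChain_map]; exact c₂.imp fun x y h => φ.map_rel_iff.2 h
    have c₃' : ((l₃.map ψ).map φ).IsChain hvGraph.Adj := by
      rw [List.isChain_map, List.isChain_map]
      exact c₃.imp fun x y h => φ.map_rel_iff.2 (ψ.map_rel_iff.2 h)
    have h₂₃ : (l₂.map φ ++ (l₃.map ψ).map φ).IsChain hvGraph.Adj := by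
      refine List.IsChain.append c₂' c₃' fun x hx y hy => ?_
      rw [List.getLast?_map, List.getLast?_eq_some_getLast h₂, Option.map_some, Option.mem_def,
        Option.some_inj] at hx
      rw [List.head?_map, List.head?_map, hd₃, Option.map_some, Option.map_some, Option.mem_def,
        Option.some_inj] at hy
      subst hx; subst hy
      exact φ.map_rel_iff.2 a₂
    refine List.IsChain.append c₁ h₂₃ fun x hx y hy => ?_
    rw [List.getLast?_eq_some_getLast h₁, Option.mem_def, Option.some_inj] at hx
    rw [List.head?_append, List.head?_map, hd₂, Option.map_some, Option.some_or, Option.mem_def,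
      Option.some_inj] at hy
    subst hx; subst hy
    exact a₁
  · rw [List.head?_append, hd₁]; rfl
  · rw [List.getLast_append_of_ne_nil _ (List.append_ne_nil_of_right_ne_nil _ h3),
      List.getLast_append_of_ne_nil _ h3, List.getLast_map, List.getLast_map]
    exact φ.map_rel_iff.2 (ψ.map_rel_iff.2 a₃)
  · -- self-avoiding: each piece is, and the three placed domains are pairwise disjoint
    refine List.Nodup.append n₁ (List.Nodup.append (n₂.map φ.injective)
      ((n₃.map ψ.injective).map φ.injective) ?_) ?_
    · intro x hx₂ hx₃
      obtain ⟨y, hy, rfl⟩ := List.mem_map.1 hx₂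
      obtain ⟨y', hy', hyy⟩ := List.mem_map.1 hx₃
      obtain ⟨z, hz, rfl⟩ := List.mem_map.1 hy'
      exact d₂₃ y (m₂ y hy) z (m₃ z hz) (φ.injective hyy).symm
    · intro x hx₁ hx
      rcases List.mem_append.1 hx with hx₂ | hx₃
      · obtain ⟨y, hy, rfl⟩ := List.mem_map.1 hx₂
        exact d₁₂ _ (m₁ _ hx₁) y (m₂ y hy) rfl
      · obtain ⟨y', hy', rfl⟩ := List.mem_map.1 hx₃
        obtain ⟨z, hz, rfl⟩ := List.mem_map.1 hy'
        exact d₁₃ _ (m₁ _ hx₁) z (m₃ z hz) rfl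
  · -- non-retracing at the end: the exit vertex is neither `w` nor a glued vertex
    intro h
    rcases prevOf_mem (l₁ ++ (l₂.map φ ++ (l₃.map ψ).map φ)) with h' | h'
    · exact huw (h.trans h')
    · exact hu (hMW _ (h ▸ h'))

/-- **The final dart of the glued walk** is `(φ ψ (last cell of γ₃), exit vertex)`.
[cite: KrachunPanagiotis2026, §3.2 (construction (b))] -/
theorem kpGlueB_finalDart (h₃ : l₃ ≠ []) (l₁ l₂ : List HV) (u : HV) :
    finalDart (wOut :: (l₁ ++ (l₂.map φ ++ (l₃.map ψ).map φ) ++ [u])) =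
      (φ (ψ (l₃.getLast h₃)), u) := by
  have h3 : (l₃.map ψ).map φ ≠ [] := by simp [h₃]
  rw [finalDart_cons_append (List.append_ne_nil_of_right_ne_nil _
      (List.append_ne_nil_of_right_ne_nil _ h3)),
    List.getLast_append_of_ne_nil _ (List.append_ne_nil_of_right_ne_nil _ h3),
    List.getLast_append_of_ne_nil _ h3, List.getLast_map, List.getLast_map]

/-- **The lengths add**: the glued walk visits `|l₁| + |l₂| + |l₃|` vertices.
[cite: KrachunPanagiotis2026, §3.2 (construction (b))] -/
theorem kpGlueB_mwLen (l₁ l₂ l₃ : List HV) (u : HV) :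
    mwLen (wOut :: (l₁ ++ (l₂.map φ ++ (l₃.map ψ).map φ) ++ [u])) =
      l₁.length + l₂.length + l₃.length := by
  rw [mwLen_cons_append]
  simp only [List.length_append, List.length_map, Nat.add_assoc]

end Glue


/-! ### Coordinates of the two placements -/

/-- **The second piece in the lattice**: a cell `Y` of the clipped triangle `C(i, x₁)` has slanted
level `≤ i` in its own frame, and its placement `φ Y`, `φ = attach x₀ x₁` (`x₀ + x₁ = k`,
`-k ≤ x₀`, `0 ≤ x₁`), has slanted level `k + 1 + Y₁ ≥ k + 1` and lies in `S_{N+1,N+1}` for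
`6k + 4i + 4 ≤ N + 1` (heights `x₁ - Y₀ ≤ 2k + i`, columns in `[-k-i, k+i]`).
[cite: KrachunPanagiotis2026, §3.2 (Trap_{2i+1,x} ⊆ Tria_{2i+1,x} = x + e^{-πi/3} Tria_{2i+1})] -/
theorem kpGlueB_region₂ {k i N : ℕ} {x₀ x₁ : ℤ} (hk : x₀ + x₁ = k) (hx₀ : -(k : ℤ) ≤ x₀)
    (hx₁ : 0 ≤ x₁) (hN : 6 * k + 4 * i + 4 ≤ N + 1) {y : HV} (hy : y ∈ clipV i x₁.toNat) :
    slev y ≤ i ∧ (k : ℤ) + 1 ≤ slev (attach x₀ x₁ y) ∧ attach x₀ x₁ y ∈ stripV (N + 1) (N + 1) := by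
  rw [mem_clipV_iff, Int.toNat_of_nonneg hx₁] at hy
  rw [mem_stripV_iff]
  have hN' : (6 * k + 4 * i + 4 : ℤ) ≤ N + 1 := by exact_mod_cast hN
  obtain ⟨a, b, c⟩ := y
  cases c <;> simp [lev, bit] at hy ⊢ <;> omega

/-- **The third piece in the lattice**: for a cell `z` of `T_r`, `r = x₁ - p₀` (`p₀ + p₁ = i`,
`-i ≤ p₀ ≤ x₁`, `2k ≤ i`), the cell `ψ z`, `ψ = attach p₀ p₁`, of the second frame has slanted level
`i + 1 + z₁ ≥ i + 1`, and `φ (ψ z)` has slanted level `k + 1 + (p₁ - z₀) ≥ k + 1` and lies in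
`S_{N+1,N+1}` for `6k + 4i + 4 ≤ N + 1` (heights `≤ 2r ≤ 4k + 2i`, columns in `[-k, 5k + 3i + 1]`).
[cite: KrachunPanagiotis2026, §3.2 (the triangle y + e^{4πi/3} Tria_{2r} of construction (b))] -/
theorem kpGlueB_region₃ {k i N : ℕ} {x₀ x₁ p₀ p₁ : ℤ} (hk : x₀ + x₁ = k) (hx₀ : -(k : ℤ) ≤ x₀)
    (hp : p₀ + p₁ = i) (hp₀ : -(i : ℤ) ≤ p₀) (hph : p₀ ≤ x₁) (hki : 2 * k ≤ i)
    (hN : 6 * k + 4 * i + 4 ≤ N + 1) {z : HV} (hz : z ∈ triV (x₁ - p₀).toNat) :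
    (i : ℤ) + 1 ≤ slev (attach p₀ p₁ z) ∧ (k : ℤ) + 1 ≤ slev (attach x₀ x₁ (attach p₀ p₁ z)) ∧
      attach x₀ x₁ (attach p₀ p₁ z) ∈ stripV (N + 1) (N + 1) := by
  rw [mem_triV_iff, Int.toNat_of_nonneg (sub_nonneg.2 hph)] at hz
  rw [mem_stripV_iff]
  have hN' : (6 * k + 4 * i + 4 : ℤ) ≤ N + 1 := by exact_mod_cast hN
  have hki' : (2 * k : ℤ) ≤ i := by exact_mod_cast hki
  obtain ⟨a, b, c⟩ := z
  cases c <;> simp [lev, bit] at hz ⊢ <;> omega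

/-- Slanted levels of the placements of a vertex `z` of the third frame with `0 ≤ z₁` and
`z₀ ≤ r = x₁ - p₀` (the cells of `T_r` and the exit vertex of the third piece): `slev (ψ z) ≥ i + 1`
and `slev (φ (ψ z)) ≥ k + 1`. [cite: KrachunPanagiotis2026, §3.2 (construction (b))] -/
theorem kpGlueB_slev₃ {k i : ℕ} {x₀ x₁ p₀ p₁ : ℤ} (hk : x₀ + x₁ = k) (hx₀ : -(k : ℤ) ≤ x₀)
    (hp : p₀ + p₁ = i) (hki : 2 * k ≤ i) {z : HV} (hz₁ : 0 ≤ z.2.1) (hz₀ : z.1 ≤ x₁ - p₀) :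
    (i : ℤ) + 1 ≤ slev (attach p₀ p₁ z) ∧ (k : ℤ) + 1 ≤ slev (attach x₀ x₁ (attach p₀ p₁ z)) := by
  rw [slev_attach, slev_attach, attach_snd_fst]
  have hki' : (2 * k : ℤ) ≤ i := by exact_mod_cast hki
  constructor <;> omega

/-- **The exit of construction (b)**: the final right dart `((z₀,z₁,false), (z₀,z₁,true))` of the
third piece (`z₀ + z₁ = r = x₁ - p₀`) is placed by `φ ∘ ψ` onto the floor dart
`((d, 0, false), (d, -1, true))`, `d = k + 1 + p₁ - z₀` ("end on its side that lies on the real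
axis"). [cite: KrachunPanagiotis2026, §3.2 (construction (b))] -/
theorem kpGlueB_exit {k : ℕ} {x₀ x₁ p₀ z₀ z₁ : ℤ} (p₁ : ℤ) (hk : x₀ + x₁ = k)
    (hz : z₀ + z₁ = x₁ - p₀) :
    attach x₀ x₁ (attach p₀ p₁ (z₀, z₁, false)) = ((k : ℤ) + 1 + p₁ - z₀, 0, false) ∧
      attach x₀ x₁ (attach p₀ p₁ (z₀, z₁, true)) = ((k : ℤ) + 1 + p₁ - z₀, -1, true) := by
  simp only [attach_apply, bit_false, bit_true, Bool.not_false, Bool.not_true]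
  refine ⟨Prod.ext ?_ (Prod.ext ?_ rfl), Prod.ext ?_ (Prod.ext ?_ rfl)⟩ <;> dsimp only <;> omega

/-! ### The registered stub -/

/-- **Registered sub-goal `stub_kp_glueB`** (crux item stmt-CriticalPhenomena-0808, line
`root-locality-replaces-loewner`): Krachun–Panagiotis's construction (b).  For `γ₁ ∈ rightWalks k`
exiting at the cell `(x₀, x₁)`, `γ₂` a walk of the clipped triangle `C(i, x₁)` (`2k ≤ i`) to its right
side exiting at `(p₀, p₁)`, and `γ₃ ∈ rightWalks (x₁ - p₀)`, the glued list
`γ₁ ++ (γ₂.map φ).drop 2 ++ ((γ₃.map ψ).map φ).drop 2` (`φ = attach x₀ x₁`, `ψ = attach p₀ p₁`) is a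
self-avoiding mid-edge walk of the strip `S_{N+1,N+1}` (`6k + 4i + 4 ≤ N + 1`) leaving through the
floor at the offset `d = k + 1 + p₁ - z₀ ∈ [i + 1 - k, 3k + 3i + 1]` (`z₀` the first coordinate of the
exit cell of `γ₃`), its length is the sum of the three lengths, the second and third pieces live at
slanted levels `≥ k + 1`, and the third at slanted levels `≥ i + 1` of the second frame.
[cite: KrachunPanagiotis2026, §3.2 (construction (b), Fig. 5)] -/
theorem stub_kp_glueB : ∀ (k i N : ℕ) (P₁ P₂ P₃ : List Literature.Probability.RandomPlanarGeometry.SAW.HV) (x₀ x₁ p₀ p₁ : ℤ), P₁ ∈ rightWalks k → Literature.Probability.RandomPlanarGeometry.SAW.HV.finalDart P₁ = ((x₀, x₁, false), (x₀, x₁, true)) → 2 * k ≤ i → P₂ ∈ Literature.Probability.RandomPlanarGeometry.SAW.HV.midWalks (clipV i x₁.toNat) → Literature.Probability.RandomPlanarGeometry.SAW.HV.finalDart P₂ = ((p₀, p₁, false), (p₀, p₁, true)) → Literature.Probability.RandomPlanarGeometry.SAW.HV.IsRightDart i (Literature.Probability.RandomPlanarGeometry.SAW.HV.finalDart P₂)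 → P₃ ∈ rightWalks (x₁ - p₀).toNat → 6 * k + 4 * i + 4 ≤ N + 1 → (P₁ ++ (P₂.map (attach x₀ x₁)).drop 2 ++ ((P₃.map (attach p₀ p₁)).map (attach x₀ x₁)).drop 2) ∈ Literature.Probability.RandomPlanarGeometry.SAW.HV.midWalks (Literature.Probability.RandomPlanarGeometry.SAW.HV.stripV (N + 1) (N + 1)) ∧ Literature.Probability.RandomPlanarGeometry.SAW.HV.finalDart (P₁ ++ (P₂.map (attach x₀ x₁)).drop 2 ++ ((P₃.map (attach p₀ p₁)).map (attach x₀ x₁)).drop 2) = ((k + 1 + p₁ - (Literature.Probability.RandomPlanarGeometry.SAW.HV.finalDart P₃).1.1, 0, false), (k + 1 + p₁ - (Literature.Probability.RandomPlanarGeometry.SAW.HV.finalDart P₃).1.1, -1, true)) ∧ Literature.Probability.RandomPlanarGeometry.SAW.HV.mwLen (P₁ ++ (P₂.map (attach x₀ x₁)).drop 2 ++ ((P₃.map (attach p₀ p₁)).map (attach x₀ x₁)).drop 2) = Literature.Probability.RandomPlanarGeometry.SAW.HV.mwLen P₁ + Literature.Probability.RandomPlanarGeometry.SAW.HV.mwLen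 P₂ + Literature.Probability.RandomPlanarGeometry.SAW.HV.mwLen P₃ ∧ (∀ v ∈ (P₂.map (attach x₀ x₁)).drop 2 ++ ((P₃.map (attach p₀ p₁)).map (attach x₀ x₁)).drop 2, (k : ℤ) + 1 ≤ slev v) ∧ (∀ v ∈ (P₃.map (attach p₀ p₁)).drop 2, (i : ℤ) + 1 ≤ slev v) ∧ (i : ℤ) + 1 - k ≤ k + 1 + p₁ - (Literature.Probability.RandomPlanarGeometry.SAW.HV.finalDart P₃).1.1 ∧ k + 1 + p₁ - (Literature.Probability.RandomPlanarGeometry.SAW.HV.finalDart P₃).1.1 ≤ 3 * k + 3 * i + 1 := by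
  intro k i N P₁ P₂ P₃ x₀ x₁ p₀ p₁ hP₁ hfd₁ hki hP₂ hfd₂ hR₂ hP₃ hN
  -- piece 1: `γ₁ ∈ D(Tria_{2k+1})` exits at the cell `(x₀, x₁)`: `x₀ + x₁ = k`, `0 ≤ x₁`, `-k ≤ x₀`
  rw [rightWalks, mem_filter, mem_midWalks_iff, hfd₁] at hP₁
  obtain ⟨hW₁, hk, -, -⟩ := hP₁
  dsimp only at hk
  obtain ⟨l₁, h₁, rfl, -, -, hxV⟩ := kpGlueB_anatomy hW₁ hfd₁
  rw [mem_triV_iff] at hxV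
  simp only [bit_false, add_zero] at hxV
  -- piece 2: a walk of the clipped triangle to its right side, exit cell `(p₀, p₁)`, `p₀ + p₁ = i`
  rw [mem_midWalks_iff] at hP₂
  rw [hfd₂] at hR₂
  obtain ⟨hp, -, -⟩ := hR₂
  dsimp only at hp
  obtain ⟨l₂, h₂, rfl, -, hd₂, hpV⟩ := kpGlueB_anatomy hP₂ hfd₂
  rw [mem_clipV_iff, Int.toNat_of_nonneg hxV.1] at hpV
  simp only [bit_false, add_zero] at hpV
  obtain ⟨-, -, -, m₂, -, -⟩ := (isMidWalk_cons_append_iff _ h₂ _).1 hP₂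
  -- piece 3: `γ₃ ∈ rightWalks r`, `r = x₁ - p₀`, exit cell `(z₀, z₁)`, `z₀ + z₁ = r`
  rw [rightWalks, mem_filter, mem_midWalks_iff] at hP₃
  obtain ⟨hW₃, hz, hzb, hz2⟩ := hP₃
  have hr : (((x₁ - p₀).toNat : ℕ) : ℤ) = x₁ - p₀ := Int.toNat_of_nonneg (by omega)
  obtain ⟨z₀, z₁, hfd₃, hzr⟩ : ∃ z₀ z₁ : ℤ, finalDart P₃ = ((z₀, z₁, false), (z₀, z₁, true)) ∧
      z₀ + z₁ = x₁ - p₀ :=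
    ⟨(finalDart P₃).1.1, (finalDart P₃).1.2.1, Prod.ext (Prod.ext rfl (Prod.ext rfl hzb)) hz2,
      hz.trans hr⟩
  rw [hfd₃]
  obtain ⟨l₃, h₃, rfl, last₃, hd₃, -⟩ := kpGlueB_anatomy hW₃ hfd₃
  obtain ⟨-, -, -, m₃, -, -⟩ := (isMidWalk_cons_append_iff _ h₃ _).1 hW₃
  have hzV := m₃ _ (List.getLast_mem h₃)
  rw [last₃, mem_triV_iff, hr] at hzV
  simp only [bit_false, add_zero] at hzV
  -- the glued list `w :: (l₁ ++ (l₂.map φ ++ (l₃.map ψ).map φ) ++ [φ (ψ (z₀, z₁, true))])`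
  rw [← attach_hvOrigin x₀ x₁] at hW₁ ⊢
  rw [← attach_hvOrigin p₀ p₁] at hP₂ ⊢
  rw [kpGlueB_eq (attach x₀ x₁) (attach p₀ p₁) hd₂ hd₃]
  obtain ⟨e₀, e₁⟩ := kpGlueB_exit p₁ hk hzr
  have hR₂ := fun y (hy : y ∈ clipV i x₁.toNat) => kpGlueB_region₂ hk hxV.2.1 hxV.1 hN hy
  have hR₃ := fun z (hz : z ∈ triV (x₁ - p₀).toNat) =>
    kpGlueB_region₃ hk hxV.2.1 hp hpV.2.1 hpV.2.2.2 hki hN hz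
  have hU₃ := kpGlueB_slev₃ hk hxV.2.1 hp hki (z := (z₀, z₁, true)) hzV.1 (by dsimp only; omega)
  refine ⟨?_, ?_, ?_, ?_, ?_, ?_, ?_⟩
  · -- a self-avoiding mid-edge walk of the strip
    refine mem_midWalks_iff.2 (kpGlueB_isMidWalk (V₁ := triV k) (V₂ := clipV i x₁.toNat)
      (V₃ := triV (x₁ - p₀).toNat) _ _ h₁ h₂ h₃ hW₁ hP₂ hW₃
      (fun x hx => triV_subset_stripV (by omega) (by omega) hx) (fun y hy => (hR₂ y hy).2.2)
      (fun z hz => (hR₃ z hz).2.2) ?_ ?_ ?_ ?_ ?_)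
    · intro x hx y hy h
      have h1 := (mem_triV_iff.1 hx).2.2
      have h2 := (hR₂ y hy).2.1
      rw [← h, slev] at h2
      omega
    · intro x hx z hz h
      have h1 := (mem_triV_iff.1 hx).2.2
      have h2 := (hR₃ z hz).2.1
      rw [← h, slev] at h2
      omega
    · intro y hy z hz h
      have h1 := (hR₂ y hy).1
      have h2 := (hR₃ z hz).1
      rw [← h] at h2
      omega
    · rw [e₁, mem_stripV_iff]
      simp
    · rw [e₁]
      simp only [wOut, ne_eq, Prod.mk.injEq, and_true]
      have hki' : (2 * k : ℤ) ≤ i := by exact_mod_cast hki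
      omega
  · -- the final dart: the floor dart at offset `d = k + 1 + p₁ - z₀`
    rw [kpGlueB_finalDart _ _ h₃, last₃, e₀, e₁]
  · -- the lengths add
    rw [kpGlueB_mwLen, mwLen_cons_append, mwLen_cons_append, mwLen_cons_append]
  · -- pieces 2 and 3 live at slanted levels `≥ k + 1`
    intro v hv
    rcases List.mem_append.1 hv with hv | hv
    · obtain ⟨y, hy, rfl⟩ := kpGlueB_mem_drop_two hd₂ hv
      rcases hy with hy | rfl
      · exact (hR₂ y (m₂ y hy)).2.1
      · rw [slev_attach, attach_hvOrigin]
        dsimp only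
        omega
    · rw [List.map_map] at hv
      obtain ⟨z, hz', rfl⟩ := kpGlueB_mem_drop_two hd₃ hv
      rcases hz' with hz' | rfl
      · exact (hR₃ z (m₃ z hz')).2.1
      · exact hU₃.2
  · -- piece 3 lives at slanted levels `≥ i + 1` of the second frame
    intro v hv
    obtain ⟨z, hz', rfl⟩ := kpGlueB_mem_drop_two hd₃ hv
    rcases hz' with hz' | rfl
    · exact (hR₃ z (m₃ z hz')).1
    · exact hU₃.1
  · dsimp only
    omega
  · dsimp only
    have hki' : (2 * k : ℤ) ≤ i := by exact_mod_cast hki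
    omega

end Summit.CriticalPhenomena.SAWScalingLimit.Theorems.HexConjecture.RootLocality

end
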